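import Summits.ValiantsHypothesis.ValiantsHypothesis.Theorems.DepthWindowSmallSegment

/-!
# Route `DepthWindow` — tools for the REFRESH level of the universal slope-2 builder

Cone-free helpers (decomp-valiant lens 4, g16) supporting the crux item `HomImmHardTwoOne`
(stmt-ValiantsHypothesis-30635).  Level `2i+2` of the universal builder for `ULB₂` (`DepthWindowULBReduction`,
statement `TwoLevelRound`) REFRESHES the letters left over by the extraction level: one group absorbs all
leftover letters of the minority sign together with leftover letters of the other sign added GREEDILY while the
running sum stays positive, and every remaining leftover letter is TRIMMED into `[−e, 0]` by extracted small sums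
drawn from a common shrinking pool.  This file proves the two finite processes:

* `exists_greedy_absorb` — greedy absorption: starting from `Q ≥ 0` and adding letters `≥ −h` one at a time while
  the sum is positive ends either with everything absorbed and a positive sum, or with a sum in `[−h, 0]`;
* `exists_multiTrim` — sequential trimming of finitely many targets from one pool of goods in `[0, e]`: every
  target ends `≤ 0`, and a target NOT brought up to `≥ −e` certifies that the whole pool has been used.

References: [LimayeSrinivasanTavenas2022] full version ECCC TR22-090, Lemma 21 / Algorithm 1 (one level);
[BhargavDuttaSaxena2024] ACM ToCT 16(4):23 §5.
-/

-- layout Summits/ValiantsHypothesis/ValiantsHypothesis forces the duplicated namespace component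
set_option linter.dupNamespace false

namespace Summit.ValiantsHypothesis.ValiantsHypothesis.Theorems.DepthWindow.TreeBias

open Finset

variable {n : ℕ}

/-- **Greedy absorption.**  From `Q ≥ 0`, adding letters of `N` (each `≥ −h`) while the running sum is positive
ends with `T = N` and a positive sum, or with a sum in `[−h, 0]`. [folklore] -/
theorem exists_greedy_absorb (z : Fin n → ℤ) {Q : ℤ} (hQ : 0 ≤ Q) {h : ℕ} :
    ∀ (N : Finset (Fin n)), (∀ j ∈ N, -(h : ℤ) ≤ z j) →
    ∃ T ⊆ N, (T = N ∧ 0 < Q + ∑ j ∈ T, z j) ∨ (-(h : ℤ) ≤ Q + ∑ j ∈ T, z j ∧ Q + ∑ j ∈ T, z j ≤ 0) := by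
  classical
  intro N
  induction N using Finset.induction_on with
  | empty =>
    intro _
    refine ⟨∅, subset_refl _, ?_⟩
    rcases eq_or_lt_of_le hQ with h0 | h0
    · right; simp [← h0]
    · left; simpa using h0
  | @insert a N ha ih =>
    intro hN
    obtain ⟨T', hT'N, hcase⟩ := ih fun j hj => hN j (mem_insert_of_mem hj)
    rcases hcase with ⟨hTeq, hpos⟩ | hstop
    · by_cases hgo : 0 < Q + ∑ j ∈ T', z j + z a
      · refine ⟨insert a T', insert_subset_insert a hT'N, Or.inl ⟨by rw [hTeq], ?_⟩⟩
        rw [sum_insert (fun h => ha (hT'N h)), ← add_assoc, add_right_comm]; exact hgo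
      · refine ⟨insert a T', insert_subset_insert a hT'N, Or.inr ?_⟩
        rw [sum_insert (fun h => ha (hT'N h))]
        have hza := hN a (mem_insert_self a N)
        constructor <;> linarith
    · exact ⟨T', hT'N.trans (subset_insert a N), Or.inr hstop⟩

/-- **Sequential trimming from one pool.**  Targets `x ∈ X` with start values `s x ≤ 0` are trimmed one after
the other by goods `z j ∈ [0, e]` drawn from a common pool disjoint from `X`; `τ` assigns every used good to
its target.  Every target ends `≤ 0`; a target not brought into `[−e, 0]` certifies that the pool is exhausted.
[folklore] -/
theorem exists_multiTrim (z s : Fin n → ℤ) (e : ℕ) :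
    ∀ (X : Finset (Fin n)), (∀ x ∈ X, s x ≤ 0) →
    ∀ (Pool : Finset (Fin n)), Disjoint X Pool → (∀ j ∈ Pool, 0 ≤ z j) → (∀ j ∈ Pool, z j ≤ e) →
    ∃ (τ : Fin n → Fin n) (Used : Finset (Fin n)), Used ⊆ Pool ∧ (∀ j ∈ Used, τ j ∈ X) ∧
      ∀ x ∈ X, s x + ∑ j ∈ Used.filter (fun j => τ j = x), z j ≤ 0 ∧
        (-(e : ℤ) ≤ s x + ∑ j ∈ Used.filter (fun j => τ j = x), z j ∨ Used = Pool) := by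
  classical
  intro X
  induction X using Finset.induction_on with
  | empty =>
    intro _ Pool _ _ _
    exact ⟨id, ∅, empty_subset _, by simp, by simp⟩
  | @insert a X' ha ih =>
    intro hs Pool hdisj hg0 hge
    have hsa : s a ≤ 0 := hs a (mem_insert_self a X')
    -- trim the new target first
    obtain ⟨Ta, hTaP, hTa⟩ : ∃ Ta ⊆ Pool, s a + ∑ j ∈ Ta, z j ≤ 0 ∧
        (-(e : ℤ) ≤ s a + ∑ j ∈ Ta, z j ∨ Ta = Pool) := by
      by_cases hlt : s a < -(e : ℤ)
      · obtain ⟨T, hTP, hT⟩ := exists_trim z Pool hg0 hge hlt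
        refine ⟨T, hTP, ?_⟩
        rcases hT with ⟨h1, h2⟩ | ⟨h1, h2⟩
        · exact ⟨h2.le, Or.inl h1⟩
        · exact ⟨by have := (Nat.cast_nonneg e : (0:ℤ) ≤ e); linarith, Or.inr h1⟩
      · exact ⟨∅, empty_subset _, by simpa using hsa, Or.inl (by rw [not_lt] at hlt; simpa using hlt)⟩
    -- then the old targets from the rest of the pool
    have hdisj' : Disjoint X' (Pool \ Ta) :=
      (disjoint_of_subset_left (subset_insert a X') hdisj).mono_right sdiff_subset
    obtain ⟨τ', Used', hU'P, hτ', hprop'⟩ := ih (fun x hx => hs x (mem_insert_of_mem hx)) (Pool \ Ta) hdisj'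
      (fun j hj => hg0 j (mem_sdiff.1 hj).1) (fun j hj => hge j (mem_sdiff.1 hj).1)
    let τ : Fin n → Fin n := fun j => if j ∈ Ta then a else τ' j
    have hU'Ta : ∀ j ∈ Used', j ∉ Ta := fun j hj => (mem_sdiff.1 (hU'P hj)).2
    have haX' : ∀ x ∈ X', x ≠ a := fun x hx h => ha (h ▸ hx)
    refine ⟨τ, Ta ∪ Used', union_subset hTaP (hU'P.trans sdiff_subset), fun j hj => ?_, fun x hx => ?_⟩
    · rcases mem_union.1 hj with h | h
      · simp [τ, h]
      · simp [τ, hU'Ta j h, hτ' j h]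
    · rcases mem_insert.1 hx with rfl | hx'
      · -- the new target: its goods are exactly `Ta`
        have hset : (Ta ∪ Used').filter (fun j => τ j = x) = Ta := by
          ext j
          simp only [mem_filter, mem_union, τ]
          constructor
          · rintro ⟨h | h, h2⟩
            · exact h
            · rw [if_neg (hU'Ta j h)] at h2; exact absurd h2 (haX' _ (hτ' j h))
          · intro h; exact ⟨Or.inl h, by simp [h]⟩
        rw [hset]
        refine ⟨hTa.1, hTa.2.imp id fun h => ?_⟩
        -- pool exhausted by `Ta`: nothing was left for the others
        have : Used' = ∅ := subset_empty.1 (by simpa [h] using hU'P)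
        rw [this, h, union_empty]
      · -- an old target: its goods are those assigned by `τ'`
        have hset : (Ta ∪ Used').filter (fun j => τ j = x) = Used'.filter (fun j => τ' j = x) := by
          ext j
          simp only [mem_filter, mem_union, τ]
          constructor
          · rintro ⟨h | h, h2⟩
            · rw [if_pos h] at h2; exact absurd h2.symm (haX' x hx')
            · rw [if_neg (hU'Ta j h)] at h2; exact ⟨h, h2⟩
          · rintro ⟨h, h2⟩; exact ⟨Or.inr h, by rw [if_neg (hU'Ta j h)]; exact h2⟩
        rw [hset]
        refine ⟨(hprop' x hx').1, (hprop' x hx').2.imp id fun h => ?_⟩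
        rw [h, union_sdiff_of_subset hTaP]

end Summit.ValiantsHypothesis.ValiantsHypothesis.Theorems.DepthWindow.TreeBias
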